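import Mathlib
import Literature.Geometry.Manifold.FlatTorus
import Literature.AlgebraicGeometry.Tropical.TorusCycles
import HarnessLib

/-!
# Geometric Lagrangian lifts of tropical cycles in a flat symplectic torus

Statement-level (T0) definitions, no theorems claimed. The setting of the tropical-to-Lagrangian
correspondence for tori: a tropical torus `B = ℝⁿ/Γℤⁿ` with integral affine structure `ℤⁿ`
(`Literature.AlgebraicGeometry.Tropical.TropicalTorusCycle`, slope lattice `ℤⁿ`) has the flat symplectic torus
`𝕏(B) := T^*B/T^*_ℤ B = (ℝⁿ/Γℤⁿ) × (ℝⁿ)^*/(ℤⁿ)^*` with `ω₀ = ∑ dx_i ∧ dy_i` and the Lagrangian torus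
fibration `𝕏(B) → B`; a tropical `p`-cycle `V ⊂ B` has the piecewise-linear PERIODISED CONORMAL
`N^*V/N^*_ℤ V`, over the interior of a top cell `σ` the affine Lagrangian sheets
`σ × (a_σ + L_σ^⊥/(L_σ^⊥ ∩ ℤⁿ))`, and a **geometric Lagrangian lift** of `V` is a compact smooth
Lagrangian that lies over a small neighbourhood of `|V|` and coincides with these sheets (with
multiplicity the weight) away from the codimension-one skeleton — J. Hicks, *Realizability in
tropical geometry and unobstructedness of Lagrangian submanifolds* [Hicks2025Realizability],
§3, Def. 3.0.2 ("geometric Lagrangian lift"; there for hypersurfaces and curves, built from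
Lagrangian pairs of pants), G. Mikhalkin [Mikhalkin2019TropicalLagrangian] §§1–2 (tropical curves
↦ Lagrangians in `(ℂ^×)ⁿ` and in symplectic tori), and for the symplectic linear algebra
D. McDuff, D. Salamon [McDuffSalamon2017], §1.1 (1.1.20) (`ω₀`), §2.1, Lemma 2.3.2 / §3.4
(Lagrangian subspaces and submanifolds, graded via the squared phase `det²` of a unitary frame).

## What is defined

* `cotangentFrame Γ`, `CotangentTorus Γ` — `𝕏 = ℝ^{n ⊕ n}/(Γℤⁿ × ℤⁿ)` as a
  `Literature.Geometry.Manifold.FlatTorus` charted on `EuclideanSpace ℝ (n ⊕ n)` (so it is a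
  compact real-analytic manifold for `𝓘(ℝ, EuclideanSpace ℝ (n ⊕ n))`, tangent spaces `=` the
  model space); `CotangentTorus.pt Γ b y` the point with base coordinate `b ∈ ℝⁿ` and fibre
  coordinate `y ∈ (ℝⁿ)^* = ℝⁿ`; `baseRep` a (discontinuous) choice of base coordinate.
* `cotangentSymplecticForm` (`ω₀((x,y),(x',y')) = ∑ (x_i y'_i - y_i x'_i)`), `complexCoord`
  (`z_i = x_i + i y_i`, the `ω₀`-compatible complex structure `J₀(x,y) = (-y,x)`).
* For a map `f : L → CotangentTorus Γ` from a manifold charted on `EuclideanSpace ℝ n`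
  (half dimension): `IsLagrangianImmersion` (smooth, injective differential, `f^*ω₀ = 0`),
  `tangentFrame` / `IsGraded` (the squared phase `det_ℂ(Z_x)²/|det_ℂ(Z_x)|²` of the complexified
  tangent frame admits a continuous real logarithm: zero Maslov class, Seidel's grading),
  `IsConormalOver V ε f` (over the `ε`-core of every cell of `V` the image of `f` is EXACTLY
  `weight` distinct parallel conormal sheets and `f` is injective there) and the bundle
  `IsGeometricLift V ε f` (Lagrangian immersion + graded + `ε`-close to `|V|` over the base +
  conormal over the cores).

## Faithfulness and what is deliberately NOT here

Hicks's Def. 3.0.2 asks for an embedded Lagrangian SUBMANIFOLD Hausdorff-close to the periodised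
conormal; here the lift is an IMMERSION of a compact manifold (clean self-intersections along tori
are expected at vertices where several top cells meet transversally, e.g. two complex planes
through a point, whose graded surgery is impossible in the holomorphic-Lagrangian degree), it is
required to be GRADED, and closeness is imposed over the base only, the fibre behaviour being
pinned exactly over the cell cores (which determines the `(p,p)`-Künneth component of the
fundamental class: `[L]_{(p,p)} = ∑_σ w_σ [σ × T_σ] = cyc V`). Orientations, (relative) spin
structures, local systems / bounding cochains and every Floer-theoretic notion are NOT defined
here (no `J`-holomorphic curve theory in Mathlib); statements needing them stay informal.
-/

noncomputable section

open scoped Manifold ContDiff Pointwise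
open Matrix

namespace Literature.Geometry.Symplectic

open Literature.Geometry.Manifold (FlatTorus)
open Literature.AlgebraicGeometry.Tropical (TropicalTorusCycle)

variable {n : Type} [Fintype n] [DecidableEq n]

/-- The lattice frame of `𝕏 = ℝ^{n ⊕ n}/(Γℤⁿ × ℤⁿ)`: `(z₁, z₂) ↦ (Γ z₁, z₂)` followed by the
identification `ℝ^{n ⊕ n} = EuclideanSpace ℝ (n ⊕ n)`; the columns are a basis of the period
lattice `Γ₁ × Γ₂^* = Γℤⁿ × ℤⁿ` of the flat symplectic torus `T^*B/T^*_ℤB` of the tropical torus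
`B = ℝⁿ/Γℤⁿ` with integral structure `ℤⁿ`. [cite: Hicks2025Realizability, §3] -/
def cotangentFrame (Γ : Matrix n n ℝ) [Invertible Γ] :
    ((n ⊕ n) → ℝ) ≃L[ℝ] EuclideanSpace ℝ (n ⊕ n) :=
  LinearEquiv.toContinuousLinearEquiv <|
    (LinearEquiv.sumArrowLequivProdArrow n n ℝ ℝ) ≪≫ₗ
      (LinearEquiv.prodCongr (Matrix.toLinearEquiv' Γ ‹_›) (LinearEquiv.refl ℝ (n → ℝ))) ≪≫ₗ
      (LinearEquiv.sumArrowLequivProdArrow n n ℝ ℝ).symm ≪≫ₗ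
      (WithLp.linearEquiv 2 ℝ ((n ⊕ n) → ℝ)).symm

/-- **The flat symplectic torus `𝕏(B) = T^*B/T^*_ℤ B`** of the tropical torus `B = ℝⁿ/Γℤⁿ`
(integral structure `ℤⁿ`): the compact real-analytic manifold `ℝ^{n ⊕ n}/(Γℤⁿ × ℤⁿ)` charted on
`EuclideanSpace ℝ (n ⊕ n)`, carrying the constant symplectic form `cotangentSymplecticForm` and the
Lagrangian torus fibration `(x, y) ↦ x` over `B`. [cite: Hicks2025Realizability, §3] -/
abbrev CotangentTorus (Γ : Matrix n n ℝ) [Invertible Γ] : Type :=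
  FlatTorus (cotangentFrame Γ)

namespace CotangentTorus

variable (Γ : Matrix n n ℝ) [Invertible Γ]

/-- The point of `𝕏(B)` with base coordinate `b ∈ ℝⁿ` (modulo `Γℤⁿ`) and fibre coordinate
`y ∈ ℝⁿ = (ℝⁿ)^*` (modulo `ℤⁿ`). [cite: Hicks2025Realizability, §3] -/
def pt (b y : n → ℝ) : CotangentTorus Γ :=
  FlatTorus.mk (cotangentFrame Γ) (Sum.elim (⅟Γ *ᵥ b) y)

/-- A base coordinate of `t ∈ 𝕏(B)` in `ℝⁿ` (a discontinuous section of `ℝⁿ → ℝⁿ/Γℤⁿ`; only its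
class modulo `Γℤⁿ` is meaningful and only that is used). [cite: Hicks2025Realizability, §3] -/
def baseRep (t : CotangentTorus Γ) : n → ℝ :=
  Γ *ᵥ fun i => FlatTorus.lift (cotangentFrame Γ) t (Sum.inl i)

end CotangentTorus

/-- The constant symplectic form `ω₀((x, y), (x', y')) = ∑_i (x_i y'_i - y_i x'_i)` on the model
space `EuclideanSpace ℝ (n ⊕ n)` (`Sum.inl` = base, `Sum.inr` = fibre coordinates): the canonical
form of `T^*B`, translation invariant, hence a form on every tangent space of `CotangentTorus Γ`
(`= EuclideanSpace ℝ (n ⊕ n)`). [cite: McDuffSalamon2017, §1.1 (1.1.20)] -/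
def cotangentSymplecticForm (u v : EuclideanSpace ℝ (n ⊕ n)) : ℝ :=
  ∑ i : n, (u (Sum.inl i) * v (Sum.inr i) - u (Sum.inr i) * v (Sum.inl i))

/-- Complex coordinates `z_i = x_i + i·y_i` of a tangent vector, for the `ω₀`-compatible complex
structure `J₀(x, y) = (-y, x)` (`z(J₀u) = i·z(u)`, `ω₀(u, J₀u) = |u|²`).
[cite: McDuffSalamon2017, §1.1] -/
def complexCoord (u : EuclideanSpace ℝ (n ⊕ n)) : n → ℂ :=
  fun i => (u (Sum.inl i) : ℂ) + Complex.I * (u (Sum.inr i) : ℂ)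

section Lift

variable (Γ : Matrix n n ℝ) [Invertible Γ]
variable {L : Type} [TopologicalSpace L] [ChartedSpace (EuclideanSpace ℝ n) L]

/-- **Lagrangian immersion** `f : L → 𝕏(B)` of a manifold `L` charted on `EuclideanSpace ℝ n`
(half the dimension of `𝕏`): `f` is smooth, every differential `df_x` is injective, and
`f^*ω₀ = 0` (`ω₀(df_x v, df_x w) = 0`). [cite: McDuffSalamon2017, §3.4] -/
def IsLagrangianImmersion (f : L → CotangentTorus Γ) : Prop :=
  ContMDiff 𝓘(ℝ, EuclideanSpace ℝ n) 𝓘(ℝ, EuclideanSpace ℝ (n ⊕ n)) ∞ f ∧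
  (∀ x : L, Function.Injective
    (mfderiv 𝓘(ℝ, EuclideanSpace ℝ n) 𝓘(ℝ, EuclideanSpace ℝ (n ⊕ n)) f x)) ∧
  ∀ (x : L) (v w : TangentSpace 𝓘(ℝ, EuclideanSpace ℝ n) x),
    cotangentSymplecticForm (mfderiv 𝓘(ℝ, EuclideanSpace ℝ n) 𝓘(ℝ, EuclideanSpace ℝ (n ⊕ n)) f x v)
      (mfderiv 𝓘(ℝ, EuclideanSpace ℝ n) 𝓘(ℝ, EuclideanSpace ℝ (n ⊕ n)) f x w) = 0

/-- The complexified tangent frame of `f` at `x`: the `n × n` complex matrix whose column `j` is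
`z(df_x e_j)`, `e_j` the standard basis of the model space of `L` (read in the preferred chart at
`x`). A change of chart multiplies it on the right by a real invertible matrix, so `det²/|det|²`
is intrinsic. [cite: McDuffSalamon2017, Lemma 2.3.2] -/
def tangentFrame (f : L → CotangentTorus Γ) (x : L) : Matrix n n ℂ :=
  fun a j => complexCoord
    (mfderiv 𝓘(ℝ, EuclideanSpace ℝ n) 𝓘(ℝ, EuclideanSpace ℝ (n ⊕ n)) f x
      (EuclideanSpace.single j (1 : ℝ))) a

/-- **Graded** (zero Maslov class, with a chosen grading): the squared phase
`det_ℂ(Z_x)² / |det_ℂ(Z_x)|² ∈ U(1)` of the tangent Lagrangian planes (`Z_x = tangentFrame f x`,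
invertible at Lagrangian points) has a continuous real lift `θ`:
`det² = |det|² · e^{iθ}`. [cite: McDuffSalamon2017, §2.3] -/
def IsGraded (f : L → CotangentTorus Γ) : Prop :=
  ∃ θ : L → ℝ, Continuous θ ∧ ∀ x : L,
    (tangentFrame Γ f x).det ^ 2 =
      ((‖(tangentFrame Γ f x).det‖ ^ 2 : ℝ) : ℂ) * Complex.exp ((θ x : ℂ) * Complex.I)

end Lift

section TropicalLift

variable {g p : ℕ} (Q : Matrix (Fin g) (Fin g) ℝ) [Invertible Q]
variable {L : Type} [TopologicalSpace L] [ChartedSpace (EuclideanSpace ℝ (Fin g)) L]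

/-- The closed cell of `σ`: the convex hull of its vertices (a representative simplex in `ℝᵍ`).
[cite: Hicks2025Realizability, Def. 3.0.2] -/
def cellHull (V : TropicalTorusCycle g p Q) (σ : Fin V.numCells) : Set (Fin g → ℝ) :=
  convexHull ℝ (Set.range (V.cell σ).vertex)

/-- The `ε`-CORE of the cell `σ` of a tropical cycle: points of the closed cell at distance `≥ ε`
(within its affine span) from the boundary. [cite: Hicks2025Realizability, Def. 3.0.2] -/
def cellCore (V : TropicalTorusCycle g p Q) (σ : Fin V.numCells) (ε : ℝ) : Set (Fin g → ℝ) :=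
  {b ∈ cellHull Q V σ |
    ∀ b' ∈ affineSpan ℝ (Set.range (V.cell σ).vertex), dist b' b < ε → b' ∈ cellHull Q V σ}

/-- The conormal directions of the cell `σ`: the annihilator `L_σ^⊥ ⊂ (ℝᵍ)^* = ℝᵍ` of its direction
lattice (columns of the frame) under the standard pairing — the fibre directions of the conormal
sheet `σ × (a + L_σ^⊥)`, an affine Lagrangian of `𝕏`. [cite: Hicks2025Realizability, §3] -/
def conormalDir (V : TropicalTorusCycle g p Q) (σ : Fin V.numCells) : Set (Fin g → ℝ) :=
  {y | ∀ j : Fin p, ∑ a : Fin g, y a * ((V.cell σ).frame a j : ℝ) = 0}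

/-- **Conormal with multiplicity over the cell cores.** For every cell `σ` there are
`w_σ` fibre shifts `a_j ∈ (ℝᵍ)^*`, pairwise distinct modulo `L_σ^⊥ + ℤᵍ` (distinct sheets in
`𝕏`), such that the part of `f(L)` lying over the `ε`-core of `σ` (modulo `Qℤᵍ`) is exactly the
union of the affine Lagrangian sheets `core_ε(σ) × (a_j + L_σ^⊥)`, and `f` is injective over the
core (each sheet covered once). This pins the local model — and hence the `(p,p)`-component
`∑_σ w_σ [σ × T_σ] = [V]` of the fundamental class — away from the codimension-one skeleton.
[cite: Hicks2025Realizability, Def. 3.0.2] -/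
def IsConormalOver (V : TropicalTorusCycle g p Q) (ε : ℝ) (f : L → CotangentTorus Q) : Prop :=
  ∀ σ : Fin V.numCells, ∃ a : Fin (V.cell σ).weight → (Fin g → ℝ),
    (∀ j j', j ≠ j' →
      a j - a j' ∉ conormalDir Q V σ + Set.range (fun z : Fin g → ℤ => fun i => (z i : ℝ))) ∧
    {t ∈ Set.range f | ∃ z : Fin g → ℤ,
        CotangentTorus.baseRep Q t + Q *ᵥ (fun i => (z i : ℝ)) ∈ cellCore Q V σ ε} =
      {t | ∃ b ∈ cellCore Q V σ ε, ∃ j, ∃ c ∈ conormalDir Q V σ,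
        t = CotangentTorus.pt Q b (a j + c)} ∧
    Set.InjOn f {x | ∃ z : Fin g → ℤ,
      CotangentTorus.baseRep Q (f x) + Q *ᵥ (fun i => (z i : ℝ)) ∈ cellCore Q V σ ε}

/-- **Geometric Lagrangian lift** of the effective tropical cycle `V ⊂ B_Q = ℝᵍ/Qℤᵍ` at scale `ε`
(Hicks, Def. 3.0.2, adapted: immersed, graded): a graded Lagrangian immersion `f : L → 𝕏(B_Q)`
whose base projection stays `ε`-close to the support `|V|` and which over the `ε`-core of every cell
IS the periodised conormal with multiplicity. For `ε` larger than every cell the conditions are weak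
(intended use: `ε` small against a fixed `V`). [cite: Hicks2025Realizability, Def. 3.0.2] -/
structure IsGeometricLift (V : TropicalTorusCycle g p Q) (ε : ℝ) (f : L → CotangentTorus Q) :
    Prop where
  lagrangian : IsLagrangianImmersion Q f
  graded : IsGraded Q f
  close : ∀ x : L, ∃ (σ : Fin V.numCells) (z : Fin g → ℤ) (b : Fin g → ℝ), b ∈ cellHull Q V σ ∧
    dist (CotangentTorus.baseRep Q (f x)) (b + Q *ᵥ (fun i => (z i : ℝ))) < ε
  conormal : IsConormalOver Q V ε f

end TropicalLift


end Literature.Geometry.Symplectic
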